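import Literature.NumberTheory.Transcendental.KZCubePolynomialKernel
import Literature.NumberTheory.Transcendental.KZConstantTerm
import Literature.NumberTheory.Transcendental.KZLogCalculusProofs

/-!
# `CubeKernelStep` (stmt-KontsevichZagierPeriods-17854), line `Sketch` (layers): stub `stub_fibreNullPolynomial`

Rung K1-polynomial (Tate sector, unconditional) of the line `Cruxes/CubeKernelStep/Lines/Sketch.lean`:
a closed `(d+1)`-cube representation `t` whose integrand agrees on the cube with a polynomial `P`
over `ℚ` and all of whose slice values over the parameter coordinate `z 0 = s ∈ [0,1]` vanish is a
relation of the Kontsevich–Zagier calculus.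

Proof. (1) `t.value = 0`: by Fubini over the parameter (`KZ.integral_sliceValue`)
`t.value = ∫ s, sliceValue t s`, and `sliceValue t s = 0` for every `s` — on `[0,1]` by hypothesis,
off `[0,1]` because the slice `{x | vecCons s x ∈ [0,1]^{d+1}}` is empty. (2) Hence
`∫_{[0,1]^{d+1}} P = 0` (the integrand of `t` is `P` on the cube). (3) A polynomial of zero cube
integral represents a relation (`KZ.RFun.poly_rep_mem_relations_of_integral_eq_zero`, file
`KZCubePolynomialKernel`). (4) `t` is congruent to `[[0,1]^{d+1}, P]` (same domain, integrands equal
on it: `KZ.of_sub_of_mem_relations_of_eqOn`). No definitions are introduced.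
References: Kontsevich–Zagier 2001, §1.2 (rules (1), (3)).
-/

noncomputable section

set_option linter.dupNamespace false

namespace Summit.KontsevichZagierPeriods.KontsevichZagierPeriods.Cruxes.CubeKernelStep.Layers

open MeasureTheory Set
open Literature.NumberTheory.Transcendental
open Literature.NumberTheory.Transcendental.KZ

/-- Off the parameter interval `[0,1]` the slice of a closed-cube representation is empty, so its
slice value vanishes. [folklore] -/
theorem sliceValue_eq_zero_of_not_mem {d : ℕ} (t : IntegralRep (d + 1))
    (hdom : t.domain = Set.pi Set.univ (fun _ : Fin (d + 1) => Set.Icc (0:ℝ) 1))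
    {s : ℝ} (hs : s ∉ Set.Icc (0:ℝ) 1) : sliceValue t s = 0 := by
  rw [sliceValue_def]
  have hempty : {x : Fin d → ℝ | Matrix.vecCons s x ∈ t.domain} = ∅ := by
    ext x
    simp only [mem_setOf_eq, mem_empty_iff_false, iff_false, hdom, mem_univ_pi]
    intro hx
    exact hs (by simpa using hx 0)
  rw [hempty, Measure.restrict_empty, integral_zero_measure]

/-- A closed-cube representation all of whose slice values over `z 0 = s ∈ [0,1]` vanish has value
`0` (Fubini over the parameter coordinate). [cite: KontsevichZagier2001, §1.2] -/
theorem value_eq_zero_of_sliceValue_eq_zero {d : ℕ} (t : IntegralRep (d + 1))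
    (hdom : t.domain = Set.pi Set.univ (fun _ : Fin (d + 1) => Set.Icc (0:ℝ) 1))
    (h : ∀ s ∈ Set.Icc (0:ℝ) 1, sliceValue t s = 0) : t.value = 0 := by
  have hall : ∀ s, sliceValue t s = 0 := fun s => by
    by_cases hs : s ∈ Set.Icc (0:ℝ) 1
    · exact h s hs
    · exact sliceValue_eq_zero_of_not_mem t hdom hs
  rw [← integral_sliceValue]
  simp [hall]

/-- **Rung K1-polynomial (Tate sector): a fibre-null polynomial family is a relation.** If the
integrand of a closed `(d+1)`-cube representation agrees on the cube with a polynomial over `ℚ` and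
all its slice values over `z 0` vanish, it is a relation: its value is `0` by Fubini, so the
polynomial has zero cube integral and `[[0,1]^{d+1}, P]` is a relation
(`KZ.RFun.poly_rep_mem_relations_of_integral_eq_zero`, Stokes moves with polynomial primitives),
and `t ≡ [[0,1]^{d+1}, P]` by congruence. [cite: KontsevichZagier2001, §1.2] -/
theorem stub_fibreNullPolynomial :
    ∀ (d : ℕ) (t : IntegralRep (d + 1)) (P : MvPolynomial (Fin (d + 1)) ℚ),
      t.domain = Set.pi Set.univ (fun _ : Fin (d + 1) => Set.Icc (0:ℝ) 1) →
      Set.EqOn t.integrand (fun z => MvPolynomial.aeval z P) t.domain →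
      (∀ s ∈ Set.Icc (0:ℝ) 1, sliceValue t s = 0) → of t ∈ relations := by
  intro d t P hdom hEq hslice
  -- (1) the value of `t` is `0`
  have hval : t.value = 0 := value_eq_zero_of_sliceValue_eq_zero t hdom hslice
  -- (2) so `P` has zero cube integral
  have hint : (∫ x in KZ.cube (d + 1), (MvPolynomial.aeval x P : ℝ)) = 0 := by
    rw [← hval, IntegralRep.value, KZ.cube_eq_pi, ← hdom]
    exact (setIntegral_congr_fun (IntegralRep.measurableSet_domain_holds t) hEq).symm
  -- (3) `[[0,1]^{d+1}, P]` is a relation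
  have hpoly : of (RFun.poly P).rep ∈ relations :=
    RFun.poly_rep_mem_relations_of_integral_eq_zero (d + 1) P hint
  -- (4) congruence `t ≡ [[0,1]^{d+1}, P]`
  have hcongr : of t - of (RFun.poly P).rep ∈ relations := by
    refine of_sub_of_mem_relations_of_eqOn ?_ fun x hx => ?_
    · rw [RFun.rep_domain, hdom, KZ.cube_eq_pi]
    · rw [RFun.rep_integrand, RFun.fn_poly]
      exact hEq hx
  have h := relations.add_mem hcongr hpoly
  rwa [sub_add_cancel] at h

end Summit.KontsevichZagierPeriods.KontsevichZagierPeriods.Cruxes.CubeKernelStep.Layers
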